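import Literature.AnabelianGeometry.EtaleTheta.KummerDataOfCoreSection
import Literature.AnabelianGeometry.EtaleTheta.KummerContH1Conj
import Literature.AnabelianGeometry.EtaleTheta.ContH1Injectivity
import HarnessLib

/-!
# The conjugation action of `Π^tp_X` on the Kummer classes of a Kummer core: unit classes are PERMUTED
# (`σ·κ(u) = κ(σ̄u)`), `κ(q̈) ↦ κ(±q̈)`, and all of them die on `Δ_Θ` (proof-only)

S. Mochizuki, *The étale theta function and its Frobenioid-theoretic manifestations*, Publ. RIMS **45**
(2009) [EtTh], §1, Prop. 1.5 (ii)/(iii), PRIMS PDF p. 23 (printed 249): "`F̈² = H¹(G_K̈, Δ_Θ) →̃ (K̈^×)^∧`",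
"… `+ log(O^×_K̈)`" — the `O^×_K̈`-indeterminacy of the `Z`-action display is stable under the action of
`Π^tp_X` because `K̈/K` is Galois ("`K̈ = K(ζ₂, q_X^{1/2})`", p. 17) [cite: MochizukiEtTh2009, Prop 1.5 (iii) p.23].
Layer L2 of the abc-iut cell, seat abc-iut-L2-t12 (gen 5), ROW R184 «Prop 1.5 (iii) FACT → THEOREM» part D2:
the three Kummer-side inputs of the `Z`-action reductions (`hU`, `hQ` of
`Discharge/Sec1Prop15iiiZLawOfGenerators.lean`; `hkres`/`hkconj` of abc-iut-L2-t6's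
`Discharge/Sec1Prop15iiiOfLift.lean`) are THEOREMS for the Kummer data of a Kummer core
(abc-iut-w5-d171's `KummerCore.toKummerData`, `KummerDataOfCore.lean`; and abc-iut-L2-t6's section datum
`KummerCore.toKummerDataOfSection`, whose unit classes re-inflate to the core's —
`kumOfSection_toKddHatOfSection`). PROOF-ONLY over those files and abc-iut-w5-d125's equivariance
`CyclotomeCoefficients.conj_kummerContClass_of_smul_eq` (`KummerContH1Conj.lean`); consumed BY NAME, nothing
restated; no `def`, no instance, no `Prop` fact.

* `ThetaSetting.norm_galois_smul` — `G_{ℚ_p}` acts on `ℚ̄_p` by isometries (spectral norm);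
* `ThetaSetting.aug_smul_mem_Kdd` — `Π^tp_X` (through `aug`, image `G_K`) maps `K̈` into itself
  (`SettingGaloisFacts.map_fieldKN_le`); `exists_units_Kdd_galois` — the translate of `u ∈ K̈^×` as an element
  of `K̈^×`, a unit if `u` is; `galois_smul_qdd` — `σ̄(q̈) = ±q̈`;
* `KummerCore.conj_kumYdd_toKddHat` — **`σ·κ(u) = κ(σ̄u)`** on `H¹((Π^tp_Ÿ)^Θ, Δ_Θ)` for every `σ ∈ Π^tp_X`,
  `u ∈ K̈^×`; whence `conj_kumYdd_units` (the binder `hU`: unit classes are permuted),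
  `conj_kumYdd_qddUnit` (the binder `hQ`: `σ·κ(q̈) = κ(q̈)·κ(±1)`), `conj_kumYdd_of_mem_K`
  (classes of elements of `K` are FIXED);
* `KummerCore.res_deltaTheta_kumYdd` — **`κ(c)|_{Δ_Θ} = 1`** (`Δ_Θ ≤ (Δ^tp_Ÿ)^Θ` acts trivially on `ℚ̄_p`:
  `aug(Δ^tp) = 1`), the binder `hkres`;
* the same three for the section datum (`…_ofSection`).

HONEST FRAMING: Kummer theory over the semi-synthetic interface; nothing of [EtTh] is asserted; typed ≠
proved; no side is taken on [IUTchIII] Cor. 3.12.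
-/

noncomputable section

namespace Literature.AnabelianGeometry.EtaleTheta

open Literature.AnabelianGeometry.SemiGraphs Literature.NumberTheory.GaloisRepresentations

namespace ThetaSetting

variable {p : ℕ} [Fact p.Prime] {D : ThetaSetting p}

/-! ### Galois bookkeeping on `K̈` -/

/-- `G_{ℚ_p}` acts on `ℚ̄_p` by isometries (the norm of `ℚ̄_p` is the spectral norm).
[cite: MochizukiEtTh2009, §1 p.17] -/
theorem norm_galois_smul (g : GQp p) (x : PadicAlgCl p) : ‖g • x‖ = ‖x‖ := by
  change ‖g x‖ = ‖x‖
  rw [← PadicAlgCl.spectralNorm_eq, ← PadicAlgCl.spectralNorm_eq]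
  exact (spectralNorm_eq_of_equiv g x).symm

variable (D) in
/-- `aug σ ∈ G_K` for every `σ ∈ Π^tp_X`. [cite: MochizukiEtTh2009, §1 p.11] -/
theorem aug_mem_fixingSubgroup_K (σ : D.PiTemp) : D.aug σ ∈ D.K.fixingSubgroup := by
  rw [← D.range_aug]; exact ⟨σ, rfl⟩

variable (D) in
/-- **`Π^tp_X` maps `K̈` into itself** (`K̈ = K₂ = K(ζ₂, q_X^{1/2})` is stable under `G_K`).
[cite: MochizukiEtTh2009, §1 p.17] -/
theorem aug_smul_mem_Kdd (σ : D.PiTemp) {x : PadicAlgCl p} (hx : x ∈ D.Kdd) : D.aug σ • x ∈ D.Kdd :=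
  map_fieldKN_le D.K D.qX D.qX_mem 2 (D.aug σ) (D.aug_mem_fixingSubgroup_K σ)
    ⟨x, hx, rfl⟩

variable (D) in
/-- The Galois translate `σ̄u` of `u ∈ K̈^×` as an element of `K̈^×`; it is a unit of `O_K̈` iff `u` is.
[cite: MochizukiEtTh2009, §1 p.17] -/
theorem exists_units_Kdd_galois (σ : D.PiTemp) (u : (↥D.Kdd)ˣ) :
    ∃ u' : (↥D.Kdd)ˣ, ((u' : D.Kdd) : PadicAlgCl p) = D.aug σ • ((u : D.Kdd) : PadicAlgCl p) ∧
      (u ∈ D.unitsOKdd ↔ u' ∈ D.unitsOKdd) := by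
  have hne : D.aug σ • ((u : D.Kdd) : PadicAlgCl p) ≠ 0 := by
    rw [smul_ne_zero_iff_ne]
    exact fun h => (u : D.Kdd)⁻¹.2 |> fun _ => Units.ne_zero u (Subtype.ext h)
  refine ⟨Units.mk0 ⟨_, D.aug_smul_mem_Kdd σ (u : D.Kdd).2⟩ (fun h => hne (congrArg Subtype.val h)), rfl, ?_⟩
  change ‖((u : D.Kdd) : PadicAlgCl p)‖ = 1 ↔ ‖D.aug σ • ((u : D.Kdd) : PadicAlgCl p)‖ = 1
  rw [norm_galois_smul]

variable (D) in
/-- `σ̄(q̈) = ±q̈` for `σ ∈ Π^tp_X` (`σ̄` fixes `q_X = q̈² ∈ K`). [cite: MochizukiEtTh2009, §1 p.17] -/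
theorem galois_smul_qdd (σ : D.PiTemp) : D.aug σ • D.qdd = D.qdd ∨ D.aug σ • D.qdd = -D.qdd := by
  have hfix : D.aug σ • D.qX = D.qX :=
    (IntermediateField.mem_fixingSubgroup_iff _ _).1 (D.aug_mem_fixingSubgroup_K σ) _ D.qX_mem
  have hsq : (D.aug σ • D.qdd) ^ 2 = D.qdd ^ 2 := by
    rw [← smul_pow', show D.qdd ^ 2 = D.qX from D.sqrtqX_sq, hfix]
  exact sq_eq_sq_iff_eq_or_eq_neg.1 hsq

namespace KummerCore

variable (C : D.KummerCore)

/-! ### Conjugation PERMUTES the Kummer classes of `K̈^×` -/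

/-- **`σ·κ(u) = κ(σ̄u)`**: conjugation by `σ ∈ Π^tp_X` on `H¹((Π^tp_Ÿ)^Θ, Δ_Θ)` carries the Kummer class of
`u ∈ K̈^×` to the Kummer class of its Galois translate `σ̄u = aug(σ)·u ∈ K̈^×` (equivariance of the
continuous Kummer class; the action of `(Π^tp_X)^Θ` on `ℚ̄_p^×` is through `augTheta`, and
`augTheta ∘ toTheta = aug`). [cite: MochizukiEtTh2009, Prop 1.5 (iii) p.23] -/
theorem conj_kumYdd_toKddHat (hC : D.Compat) (σ : D.PiTemp) (u u' : (↥D.Kdd)ˣ)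
    (hu' : ((u' : D.Kdd) : PadicAlgCl p) = D.aug σ • ((u : D.Kdd) : PadicAlgCl p)) :
    haveI := hC.GtpYddTheta_normal
    ContH1.conj (MonoidHom.id D.GtpTheta) D.DeltaTheta (D.toTheta σ)
        (C.toKummerData.kumYdd (C.toKummerData.toKddHat u)) =
      C.toKummerData.kumYdd (C.toKummerData.toKddHat u') := by
  haveI := hC.GtpYddTheta_normal
  letI := D.unitsAction C.augTheta
  change ContH1.conj (MonoidHom.id D.GtpTheta) D.DeltaTheta (D.toTheta σ)
      (C.coeff.kummerContMap (D.GtpYdd.map D.toTheta) C.isOpen_stabilizer' (C.toInvYdd u)) =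
    C.coeff.kummerContMap (D.GtpYdd.map D.toTheta) C.isOpen_stabilizer' (C.toInvYdd u')
  rw [C.coeff.kummerContMap_apply_eq _ C.isOpen_stabilizer' (C.toInvYdd u)
      (RootSystem.ofRootableBy ((C.toInvYdd u : C.invYdd) : (PadicAlgCl p)ˣ)),
    C.coeff.kummerContMap_apply_eq _ C.isOpen_stabilizer' (C.toInvYdd u')
      (RootSystem.ofRootableBy ((C.toInvYdd u' : C.invYdd) : (PadicAlgCl p)ˣ))]
  refine C.coeff.conj_kummerContClass_of_smul_eq (D.GtpYdd.map D.toTheta) (D.toTheta σ) _ _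
    (C.toInvYdd u).2 (C.toInvYdd u').2 (fun _ => C.isOpen_stabilizer' _) (fun _ => C.isOpen_stabilizer' _)
    (fun n => CyclotomeCoefficients.isOpen_stabilizer_smul_root (D.toTheta σ) _
      (fun _ => C.isOpen_stabilizer' _) n) ?_
  -- `toTheta σ • u = u'` in `ℚ̄_p^×`: the action is through `augTheta (toTheta σ) = aug σ`
  apply Units.ext
  change ((C.augTheta (D.toTheta σ) • ((C.toInvYdd u : C.invYdd) : (PadicAlgCl p)ˣ) : (PadicAlgCl p)ˣ) :
      PadicAlgCl p) = ((u' : D.Kdd) : PadicAlgCl p)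
  rw [C.augTheta_toTheta, hu']
  rfl

/-- **Unit classes are permuted** (the binder `hU` of the `Z`-law reductions): for `u ∈ O^×_K̈`,
`σ·κ(u) = κ(u′)` with `u′ = σ̄u ∈ O^×_K̈` (Galois automorphisms are isometries).
[cite: MochizukiEtTh2009, Prop 1.5 (iii) p.23] -/
theorem conj_kumYdd_units (hC : D.Compat) :
    haveI := hC.GtpYddTheta_normal
    ∀ σ : D.PiTemp, ∀ u ∈ D.unitsOKdd, ∃ u' ∈ D.unitsOKdd,
      ContH1.conj (MonoidHom.id D.GtpTheta) D.DeltaTheta (D.toTheta σ)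
          (C.toKummerData.kumYdd (C.toKummerData.toKddHat u)) =
        C.toKummerData.kumYdd (C.toKummerData.toKddHat u') := by
  intro σ u hu
  obtain ⟨u', hu', hiff⟩ := D.exists_units_Kdd_galois σ u
  exact ⟨u', hiff.1 hu, C.conj_kumYdd_toKddHat hC σ u u' hu'⟩

/-- **Classes of elements of `K` are fixed**: if `u ∈ K^× ⊆ K̈^×` then `σ·κ(u) = κ(u)` for all `σ ∈ Π^tp_X`
(`aug σ ∈ G_K`). [cite: MochizukiEtTh2009, Prop 1.5 (iii) p.23] -/
theorem conj_kumYdd_of_mem_K (hC : D.Compat) (σ : D.PiTemp) (u : (↥D.Kdd)ˣ)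
    (huK : ((u : D.Kdd) : PadicAlgCl p) ∈ D.K) :
    haveI := hC.GtpYddTheta_normal
    ContH1.conj (MonoidHom.id D.GtpTheta) D.DeltaTheta (D.toTheta σ)
        (C.toKummerData.kumYdd (C.toKummerData.toKddHat u)) =
      C.toKummerData.kumYdd (C.toKummerData.toKddHat u) :=
  C.conj_kumYdd_toKddHat hC σ u u
    ((IntermediateField.mem_fixingSubgroup_iff _ _).1 (D.aug_mem_fixingSubgroup_K σ) _ huK).symm

/-- **`σ·κ(q̈) = κ(q̈)·κ(±1)`** (the binder `hQ` of the `Z`-law reductions): `σ̄(q̈) = ±q̈` and `−1 ∈ O^×_K̈`.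
[cite: MochizukiEtTh2009, Prop 1.5 (iii) p.23] -/
theorem conj_kumYdd_qddUnit (hC : D.Compat) :
    haveI := hC.GtpYddTheta_normal
    ∀ σ : D.PiTemp, ∃ u ∈ D.unitsOKdd,
      ContH1.conj (MonoidHom.id D.GtpTheta) D.DeltaTheta (D.toTheta σ)
          (C.toKummerData.kumYdd (C.toKummerData.toKddHat D.qddUnit)) =
        C.toKummerData.kumYdd (C.toKummerData.toKddHat D.qddUnit) *
          C.toKummerData.kumYdd (C.toKummerData.toKddHat u) := by
  intro σ
  rcases D.galois_smul_qdd σ with h | h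
  · refine ⟨1, D.unitsOKdd.one_mem, ?_⟩
    rw [map_one, map_one, mul_one]
    exact C.conj_kumYdd_toKddHat hC σ D.qddUnit D.qddUnit h.symm
  · refine ⟨-1, ?_, ?_⟩
    · change ‖(((-1 : (↥D.Kdd)ˣ) : D.Kdd) : PadicAlgCl p)‖ = 1
      simp
    · rw [← map_mul, ← map_mul]
      refine C.conj_kumYdd_toKddHat hC σ D.qddUnit (D.qddUnit * -1) ?_
      have e1 : ((D.qddUnit : D.Kdd) : PadicAlgCl p) = D.qdd := rfl
      have e2 : (((D.qddUnit * -1 : (↥D.Kdd)ˣ) : D.Kdd) : PadicAlgCl p) = -D.qdd := by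
        rw [Units.val_mul, Units.val_neg, Units.val_one]
        push_cast
        rw [e1, mul_neg_one]
      rw [e2, e1, h]

/-! ### Kummer classes die on `Δ_Θ` -/

/-- **`κ(c)|_{Δ_Θ} = 1`** for every `c ∈ K̈^× = KddHat` of the core's datum (the binder `hkres` of
abc-iut-L2-t6's reduction, for all of `K̈^×`): `Δ_Θ ≤ (Δ^tp_Ÿ)^Θ` acts trivially on `ℚ̄_p`
(`augTheta(toTheta g) = aug g = 1` for `g ∈ Δ^tp`), so the Kummer cocycle vanishes there.
[cite: MochizukiEtTh2009, Prop 1.5 (ii) p.23] -/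
theorem res_deltaTheta_kumYdd (hC : D.Compat) (c : C.toKummerData.KddHat) :
    ContH1.res (MonoidHom.id D.GtpTheta) D.DeltaTheta
        (hC.deltaTheta_le_DtpYddTheta.trans (Subgroup.map_mono inf_le_left)) (C.toKummerData.kumYdd c) = 1 := by
  letI := D.unitsAction C.augTheta
  obtain ⟨c', rfl⟩ : ∃ c' : C.invYdd, c' = c := ⟨c, rfl⟩
  change ContH1.res (MonoidHom.id D.GtpTheta) D.DeltaTheta _
      (C.coeff.kummerContMap (D.GtpYdd.map D.toTheta) C.isOpen_stabilizer' c') = 1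
  rw [C.coeff.kummerContMap_apply_eq _ C.isOpen_stabilizer' c'
    (RootSystem.ofRootableBy ((c' : C.invYdd) : (PadicAlgCl p)ˣ))]
  unfold CyclotomeCoefficients.kummerContClass
  change ContH1.mk _ _ = 1
  rw [ContH1.mk_eq_one_iff, mem_contCoboundaries_iff]
  refine ⟨1, funext fun h => ?_⟩
  -- `h ∈ Δ_Θ` acts trivially on the roots: `augTheta h = 1`
  obtain ⟨g, hg, hgh⟩ := Subgroup.mem_map.1 (hC.deltaTheta_le_DtpYddTheta h.2)
  have haug : C.augTheta (h : D.GtpTheta) = 1 := by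
    rw [← hgh, C.augTheta_toTheta]
    exact (Subgroup.mem_inf.1 hg).2
  have htriv : RootSystem.kummerCocycle (RootSystem.ofRootableBy ((c' : C.invYdd) : (PadicAlgCl p)ˣ)) c'.2
      ⟨(h : D.GtpTheta), (hC.deltaTheta_le_DtpYddTheta.trans (Subgroup.map_mono inf_le_left)) h.2⟩ = 1 := by
    refine Subtype.ext (funext fun n => ?_)
    rw [RootSystem.kummerCocycle_apply, Subgroup.smul_def, unitsAction_smul]
    change C.augTheta (h : D.GtpTheta) • _ / _ = _
    rw [haug, one_smul, div_self']
    rfl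
  change C.coeff.hom (RootSystem.kummerCocycle _ _ _) = _
  rw [htriv, map_one]
  simp

/-- The binder `hkres` of abc-iut-L2-t6's `prop15iii_etaleThetaDataOfClass_of_lift`, verbatim, at the core's
datum. [cite: MochizukiEtTh2009, Prop 1.5 (ii) p.23] -/
theorem res_deltaTheta_kumYdd_units (hC : D.Compat) :
    ∀ u ∈ D.unitsOKdd, ContH1.res (MonoidHom.id D.GtpTheta) D.DeltaTheta
      (hC.deltaTheta_le_DtpYddTheta.trans (Subgroup.map_mono inf_le_left))
      (C.toKummerData.kumYdd (C.toKummerData.toKddHat u)) = 1 :=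
  fun u _ => C.res_deltaTheta_kumYdd hC (C.toKummerData.toKddHat u)

/-! ### The same at the section datum `toKummerDataOfSection s` -/

section OfSection

variable (s : GQp p →* D.PiTemp) (hs : Continuous s) (hsec : ∀ σ : GQp p, D.aug (s σ) = σ)
  (hsY : D.GK.map s ≤ D.GtpY) (hsYdd : D.GKdd.map s ≤ D.GtpYdd)

include hsec in
/-- At the section datum the unit classes ARE the core's (`kumOfSection_toKddHatOfSection`), so
`σ·κ(u) = κ(σ̄u)` there as well. [cite: MochizukiEtTh2009, Prop 1.5 (iii) p.23] -/
theorem conj_kumYdd_toKddHat_ofSection (hC : D.Compat) (σ : D.PiTemp) (u u' : (↥D.Kdd)ˣ)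
    (hu' : ((u' : D.Kdd) : PadicAlgCl p) = D.aug σ • ((u : D.Kdd) : PadicAlgCl p)) :
    haveI := hC.GtpYddTheta_normal
    ContH1.conj (MonoidHom.id D.GtpTheta) D.DeltaTheta (D.toTheta σ)
        ((C.toKummerDataOfSection s hs hsec hsY hsYdd).kumYdd
          ((C.toKummerDataOfSection s hs hsec hsY hsYdd).toKddHat u)) =
      (C.toKummerDataOfSection s hs hsec hsY hsYdd).kumYdd
        ((C.toKummerDataOfSection s hs hsec hsY hsYdd).toKddHat u') := by
  haveI := hC.GtpYddTheta_normal
  change ContH1.conj (MonoidHom.id D.GtpTheta) D.DeltaTheta (D.toTheta σ)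
      (C.kumOfSection s hsec (D.GtpYdd.map D.toTheta) D.GKdd C.map_augTheta_gtpYdd.le
        (C.toKddHatOfSection s hs hsYdd u)) =
    C.kumOfSection s hsec (D.GtpYdd.map D.toTheta) D.GKdd C.map_augTheta_gtpYdd.le
      (C.toKddHatOfSection s hs hsYdd u')
  rw [C.kumOfSection_toKddHatOfSection s hs hsec hsYdd, C.kumOfSection_toKddHatOfSection s hs hsec hsYdd]
  exact C.conj_kumYdd_toKddHat hC σ u u' hu'

include hsec in
/-- `hU` at the section datum. [cite: MochizukiEtTh2009, Prop 1.5 (iii) p.23] -/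
theorem conj_kumYdd_units_ofSection (hC : D.Compat) :
    haveI := hC.GtpYddTheta_normal
    ∀ σ : D.PiTemp, ∀ u ∈ D.unitsOKdd, ∃ u' ∈ D.unitsOKdd,
      ContH1.conj (MonoidHom.id D.GtpTheta) D.DeltaTheta (D.toTheta σ)
          ((C.toKummerDataOfSection s hs hsec hsY hsYdd).kumYdd
            ((C.toKummerDataOfSection s hs hsec hsY hsYdd).toKddHat u)) =
        (C.toKummerDataOfSection s hs hsec hsY hsYdd).kumYdd
          ((C.toKummerDataOfSection s hs hsec hsY hsYdd).toKddHat u') := by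
  intro σ u hu
  obtain ⟨u', hu', hiff⟩ := D.exists_units_Kdd_galois σ u
  exact ⟨u', hiff.1 hu, C.conj_kumYdd_toKddHat_ofSection s hs hsec hsY hsYdd hC σ u u' hu'⟩

include hsec in
/-- `hQ` at the section datum. [cite: MochizukiEtTh2009, Prop 1.5 (iii) p.23] -/
theorem conj_kumYdd_qddUnit_ofSection (hC : D.Compat) :
    haveI := hC.GtpYddTheta_normal
    ∀ σ : D.PiTemp, ∃ u ∈ D.unitsOKdd,
      ContH1.conj (MonoidHom.id D.GtpTheta) D.DeltaTheta (D.toTheta σ)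
          ((C.toKummerDataOfSection s hs hsec hsY hsYdd).kumYdd
            ((C.toKummerDataOfSection s hs hsec hsY hsYdd).toKddHat D.qddUnit)) =
        (C.toKummerDataOfSection s hs hsec hsY hsYdd).kumYdd
            ((C.toKummerDataOfSection s hs hsec hsY hsYdd).toKddHat D.qddUnit) *
          (C.toKummerDataOfSection s hs hsec hsY hsYdd).kumYdd
            ((C.toKummerDataOfSection s hs hsec hsY hsYdd).toKddHat u) := by
  intro σ
  obtain ⟨u, hu, h⟩ := C.conj_kumYdd_qddUnit hC σ
  refine ⟨u, hu, ?_⟩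
  have e : ∀ v : (↥D.Kdd)ˣ, (C.toKummerDataOfSection s hs hsec hsY hsYdd).kumYdd
      ((C.toKummerDataOfSection s hs hsec hsY hsYdd).toKddHat v) =
        C.toKummerData.kumYdd (C.toKummerData.toKddHat v) :=
    fun v => C.kumOfSection_toKddHatOfSection s hs hsec hsYdd v
  rw [e, e]
  exact h

include hsec in
/-- `hkres` at the section datum, for ALL of `KddHat = H¹(G_K̈, Δ_Θ)` (every class pulled back along
`augTheta` dies on `Δ_Θ ≤ Ker augTheta`). [cite: MochizukiEtTh2009, Prop 1.5 (ii) p.23] -/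
theorem res_deltaTheta_kumYdd_ofSection (hC : D.Compat)
    (c : (C.toKummerDataOfSection s hs hsec hsY hsYdd).KddHat) :
    ContH1.res (MonoidHom.id D.GtpTheta) D.DeltaTheta
        (hC.deltaTheta_le_DtpYddTheta.trans (Subgroup.map_mono inf_le_left))
        ((C.toKummerDataOfSection s hs hsec hsY hsYdd).kumYdd c) = 1 := by
  induction c using QuotientGroup.induction_on with
  | H f =>
    change ContH1.res (MonoidHom.id D.GtpTheta) D.DeltaTheta _
        (C.kumOfSection s hsec (D.GtpYdd.map D.toTheta) D.GKdd C.map_augTheta_gtpYdd.le (ContH1.mk f.1 f.2)) = 1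
    rw [C.kumOfSection_mk]
    change ContH1.mk _ _ = 1
    rw [ContH1.mk_eq_one_iff, mem_contCoboundaries_iff]
    refine ⟨1, funext fun h => ?_⟩
    obtain ⟨g, hg, hgh⟩ := Subgroup.mem_map.1 (hC.deltaTheta_le_DtpYddTheta h.2)
    have haug : C.augTheta (h : D.GtpTheta) = 1 := by
      rw [← hgh, C.augTheta_toTheta]
      exact (Subgroup.mem_inf.1 hg).2
    have h1 : f.1 ⟨C.augTheta (h : D.GtpTheta), C.map_augTheta_gtpYdd.le
        ⟨(h : D.GtpTheta), (hC.deltaTheta_le_DtpYddTheta.trans (Subgroup.map_mono inf_le_left)) h.2, rfl⟩⟩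
        = 1 := by
      have : (⟨C.augTheta (h : D.GtpTheta), C.map_augTheta_gtpYdd.le
          ⟨(h : D.GtpTheta), (hC.deltaTheta_le_DtpYddTheta.trans (Subgroup.map_mono inf_le_left)) h.2, rfl⟩⟩ :
          ↥D.GKdd) = 1 := Subtype.ext haug
      rw [this]
      exact ContH1.cocycle_map_one _
    rw [h1]
    simp

end OfSection

end KummerCore

end ThetaSetting

end Literature.AnabelianGeometry.EtaleTheta

end
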